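/-
Copyright: the b2b-balaban T⁴-continuum CRUX team, row NE7b owner lineage `t4-ne7b-p1` (gen 113). Project licence.
-/
import Summits.QuantumFields.BalabanUV.T4Continuum.Spine.NE7b.OneShotChartSupNorm
import Summits.QuantumFields.BalabanUV.T4Continuum.Spine.NE7b.BlockPropagatorSupNorm

/-!
# THE INVERSE AUGMENTED OPERATOR OF THE GAUSSIAN SKELETON IN THE SUP CURRENCY: for the scalar block-averaging step on `ℤ^d`
# (`A = Δ^η + aQ′*Q′`, `Q′` the block mean of side `n + 1`, `H = G′Q′*(Q′G′Q′*)⁻¹`, `G′ = A⁻¹`), the FIBRE INVERSE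
# `Γψ := G′ψ − H·Q′(G′ψ)` has `Q′(Γψ) = 0` and `A(Γψ) = ψ − Q′*λ` (`λ = (Q′G′Q′*)⁻¹Q′G′ψ`, block-constant), and the pair
# `φ := Hk + Γψ` solves the augmented system `Q′φ = k`, `Aφ ≡ ψ (mod Q′*·)` with
# `‖φ‖_∞ ≤ C_∞‖k‖_∞ + A_G K_d (1 + C_∞)‖ψ‖_∞` UNIFORMLY IN THE SIDE (`d ≥ 3`) — HSCR's `‖T⁻¹y‖ ≤ N‖y‖` letter for the free
# field in HRS's currency (row NE7b, node U5c; (46) + (49) + Literature B5 columns BY NAME; [folklore] bookkeeping)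

Cell `pub-balaban`, sub-cell `t4`, spine estimate NE7b (`T4WeightBudget.RelWeightBound`; the cell's OWN estimate — NOT PRINTED
in [Bałaban 1983–89], NOT PROVED).  Crux-route work under `Spine/NE7b/` by the row OWNER (`t4-ne7b-p1` gen 113) under FREEZE
(0)'s crux-prover clause (RULING W-ne7bp1-g113-1, FILING-CLAIM C-ne7bp1-g113-6); NOTHING of Bałaban's is asserted; no
`T4Continuum/Support` leaf typed; no `def` (the three fields `G′ψ`, `Q′(G′ψ)`, `Γψ` are written out); zero `sorry`.  Imports (BY
NAME): (46) `OneShotChartSupNorm` (`summable_HBZd_of_bounded`, `abs_HBZd_le_sup`, `summable_abs_kerH_row`), (49)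
`BlockPropagatorSupNorm` (`summable_Gk_mul_of_bounded`, `abs_tsum_Gk_mul_le_sup`, `supConstG_nonneg`), and through them the
Literature columns `B5Hk103ScalarZd` (`AX`, `nbhd`, `Gk`, `Kinv`, `kerH`, `sum_AX_mul_Gk`, `tsum_AX_mul`, `tsum_AX_mul_kerH`,
`blockAvg_kerH`, `abs_Kinv_le`, `sum_mul_blockConst_eq_zero`), `B5Hk165L2Zd` (`HBZd`), the β-team's `D1BFx` sup legs.

WHY (located).  leaf-04's HSCR (`…HardStepChartRadius`) — valid on ANY complete space — turns the two displayed chart letters `T`,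
`‖T⁻¹ y‖ ≤ N‖y‖` into the hard step's background-field branch with radius `(N⁻¹ − c)·r`; in the energy currency CLSW supplies
`N = √(γ₁∕γ₀) + γ₀⁻¹`.  In the SUP currency HRS consumes (NL-NE7b-1), `T⁻¹` of the Gaussian skeleton has two columns: the section
`k ↦ Hk` ((46): `C_∞`) and the fibre inverse `ψ ↦ Γψ` — the solution IN `ker Q′` of `Aφ ≡ ψ (mod range Q′*)` — which print writes
through the block-averaged massive propagator: `Γ = G′ − G′Q′*(Q′G′Q′*)⁻¹Q′G′ = G′ − H Q′G′` ([B5] (1.103); the fluctuation covariance).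
With (49)'s `‖G′‖_{∞→∞} ≤ A_G K_d` and `‖Q′‖_{∞→∞} ≤ 1` this column costs `A_G K_d(1 + C_∞)`, mesh-uniformly.  This file proves the
two identities that make `Γ` the fibre inverse (absolutely convergent series throughout — `A` has finite rows, `H` and `G′` have `ℓ¹`
rows) and the sup letter; nothing else.

WHAT IS PROVED ([folklore]; every `d` unless marked; `n : ℕ`, `a > 0`; `ψ`, `k` BOUNDED coarse∕fine data; fields written out:
`G′ψ = fun p => Σ′_q G′(p,q)ψ(q)`, `Q′f = fun y => ((n+1)^d)⁻¹Σ_{p∈B(y)} f p`, `Hk = HBZd n a k`, `Γψ = G′ψ − H(Q′(G′ψ))`):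
* §1 `abs_blockAvg_le` (`|Q′f| ≤ M` if `|f| ≤ M`), `sum_AX_Gop` (`A(G′ψ) = ψ` row by row), `abs_Gop_le` ∕ `abs_blockAvg_Gop_le` (the
  (49) letter and its block mean).
* §2 `sum_B_HBZd_of_bounded` (`Σ_{p∈B(y″)}(Hk)(p) = (n+1)^d k(y″)` — `Q′H = 1` on `ℓ^∞` data; the tree's `sum_B_HBZd` asks `k ∈ ℓ²`),
  `summable_mul_Kinv_row`, `sum_AX_HBZd` (`A(Hk)(p) = Σ′_y k(y)(Q′G′Q′*)⁻¹(blk p, y)` — block-constant: the Lagrange multiplier).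
* §3 **`blockAvg_fibreInverse`** (`Q′(Γψ) = 0`), **`sum_AX_fibreInverse`** (`A(Γψ)(p) = ψ(p) − λ(blk p)`), `fibreInverse_weak`
  (`Σ_p κ(p)·A(Γψ)(p) = Σ_p κ(p)ψ(p)` for finitely supported `κ` with zero block sums — `Γψ` inverts `A` ON THE FIBRE),
  **`abs_fibreInverse_le_of_letters`** (parametric: `‖H‖ ≤ C_H`, `‖G′‖ ≤ C_G` ⟹ `|Γψ| ≤ C_G(1 + C_H)‖ψ‖_∞`),
  **`abs_fibreInverse_le`** (`d ≥ 3`: the instantiated letter with (46)'s `C_∞ = cHs·K_d(δ_H)` and (49)'s `A_G·K_d(δ_u∕4)`).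
* §4 **`augInverse_letters`** (`d ≥ 3`: for bounded `k`, `ψ` the field `φ = Hk + Γψ` has `Q′φ = k`, `A φ(p) = ψ(p) + (block-constant)`,
  and `|φ(p)| ≤ C_∞·R_k + A_G K_d(1 + C_∞)·R_ψ` — the sup-currency `N` letter of the Gaussian skeleton, uniform in the side).
* §5 toy.

HONEST (what this is NOT).  Constants existential ∕ useless by value; scalar `ℤ^d`; the identification of `(Q′, A, Γ)` with HSCR's
abstract `(D, V″, T⁻¹)` on an `lp ∞` carrier is NOT typed here (the operator packaging is (48)'s pattern; a leaf may socket it);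
UNIQUENESS of the fibre solution in `ℓ^∞` (Liouville-type: a bounded `A`-harmonic-mod-`Q′*` field with zero block means vanishes) is
NOT here; nothing of the covariant operators ((A3), NC-NE7b-α UNRULED).  BY-NAME EFFECT ON THE WALL: NONE.  NE7b NOT PRINTED ∕ NOT
PROVED; spine PROVED 0∕9; rung (B)+1 on a FINITE torus — NOT infinite volume, NOT the mass gap, NOT Clay.  HONEST DEPENDENCY:
continuum YM on T⁴ ⇐ BetaPertH ∧ nine spine estimates (0∕9 proved); BetaPertH ⇐ (D1) ∧ (D4) ∧ CAP+tail; G-an2-4 gates asym, D1 and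
NE2∕3∕4.
-/

set_option autoImplicit false

namespace Summit.QuantumFields.BalabanUV.T4Continuum.NE7b.FibreInverseSupNorm

open Finset Real
open Literature.MathematicalPhysics.QuantumFieldTheory.Balaban1983to89
open B4Sect5Proof (latticeConst latticeConst_nonneg)
open B6QGQLower276 (X blk B mem_B sum_B_const AX)
open B6QGQDecay237 (deltaU deltaU_pos cInv cInv_pos deltaInv deltaInv_pos)
open B5Hk103ScalarZd (Gk Kinv kerH nbhd summable_expX tsum_expX_le sum_AX_mul_Gk tsum_AX_mul tsum_AX_mul_kerH
  blockAvg_kerH abs_Kinv_le sum_mul_blockConst_eq_zero deltaH deltaH_pos)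
open B5Hk165L2Zd (HBZd)
open Summit.QuantumFields.BalabanUV.Beta.D1BFx.BlockColumnSupNorm (cHs cHs_nonneg)
open Summit.QuantumFields.BalabanUV.Beta.D1BFx.PointColumnSplit (cKL cG0 cSplit)
open Summit.QuantumFields.BalabanUV.Beta.D1BFx.PointColumnDecay (cFar)
open OneShotChartSupNorm (summable_abs_kerH_row summable_HBZd_of_bounded abs_HBZd_le_sup nonneg_of_abs_le)
open BlockPropagatorSupNorm (summable_abs_Gk_row summable_Gk_mul_of_bounded abs_tsum_Gk_mul_le_sup supConstG_nonneg)

noncomputable section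

variable {d : ℕ}

/-! ## §1. `G′` on bounded data: `A(G′ψ) = ψ`, the sup letter and its block mean -/

/-- A block mean of a field bounded by `M` is bounded by `M`: `‖Q′‖_{∞→∞} ≤ 1`. [folklore] -/
theorem abs_blockAvg_le (n : ℕ) {f : X d → ℝ} {M : ℝ} (hf : ∀ p, |f p| ≤ M) (y : X d) :
    |(((n : ℝ) + 1) ^ d)⁻¹ * ∑ p ∈ B n y, f p| ≤ M := by
  have hs : (0 : ℝ) < ((n : ℝ) + 1) ^ d := by positivity
  rw [abs_mul, abs_inv, abs_of_pos hs, inv_mul_le_iff₀ hs]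
  calc |∑ p ∈ B n y, f p| ≤ ∑ p ∈ B n y, |f p| := Finset.abs_sum_le_sum_abs _ _
    _ ≤ ∑ _p ∈ B n y, M := Finset.sum_le_sum fun p _ => hf p
    _ = ((n : ℝ) + 1) ^ d * M := sum_B_const y M

/-- **`A(G′ψ) = ψ`** row by row for bounded `ψ` (every `d`): `Σ_{r∈nbhd p} A(p,r)·(G′ψ)(r) = ψ(p)` — the finite row of `A` passes
inside the absolutely convergent rows of `G′`, and `AG′ = 1` entrywise (`sum_AX_mul_Gk`). [folklore] -/
theorem sum_AX_Gop (n : ℕ) {a : ℝ} (ha : 0 < a) {ψ : X d → ℝ} {R : ℝ} (hψ : ∀ q, |ψ q| ≤ R) (p : X d) :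
    ∑ r ∈ nbhd n p, AX n a p r * ∑' q : X d, Gk n a r q * ψ q = ψ p := by
  classical
  have hs : ∀ r ∈ nbhd n p, Summable fun q : X d => AX n a p r * (Gk n a r q * ψ q) :=
    fun r _ => (summable_Gk_mul_of_bounded n ha hψ r).mul_left _
  calc ∑ r ∈ nbhd n p, AX n a p r * ∑' q : X d, Gk n a r q * ψ q
      = ∑ r ∈ nbhd n p, ∑' q : X d, AX n a p r * (Gk n a r q * ψ q) := by
        refine Finset.sum_congr rfl fun r _ => ?_
        rw [tsum_mul_left]
    _ = ∑' q : X d, ∑ r ∈ nbhd n p, AX n a p r * (Gk n a r q * ψ q) := (Summable.tsum_finsetSum hs).symm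
    _ = ∑' q : X d, (∑ r ∈ nbhd n p, AX n a p r * Gk n a r q) * ψ q := by
        refine tsum_congr fun q => ?_
        rw [Finset.sum_mul]
        exact Finset.sum_congr rfl fun r _ => by ring
    _ = ∑' q : X d, (if p = q then 1 else 0) * ψ q := by
        refine tsum_congr fun q => ?_
        rw [sum_AX_mul_Gk n ha p q]
    _ = ψ p := by
        rw [tsum_eq_single p (fun q hq => by rw [if_neg (Ne.symm hq), zero_mul])]
        simp

/-- The (49) letter, restated for use: `|(G′ψ)(p)| ≤ A_G K_d(δ_u∕4)·R` (`d ≥ 3`). [folklore] -/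
theorem abs_Gop_le (hd : 3 ≤ d) (n : ℕ) {a : ℝ} (ha : 0 < a) {ψ : X d → ℝ} {R : ℝ} (hψ : ∀ q, |ψ q| ≤ R) (p : X d) :
    |∑' q : X d, Gk n a p q * ψ q|
      ≤ ((cG0 d * cKL d (d - 2) + cSplit d a) * Real.exp (2 * deltaU d a)
          + cFar d a * Real.exp (4 * deltaU d a) / deltaU d a ^ 2) * latticeConst d (deltaU d a / 4) * R :=
  abs_tsum_Gk_mul_le_sup hd n ha hψ p

/-! ## §2. `H` on bounded data: `Q′H = 1` and the Lagrange multiplier `A(Hk) = Q′*((Q′G′Q′*)⁻¹k)` -/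

/-- **`Q′H = 1` on `ℓ^∞` data** (every `d`): `Σ_{p∈B(y″)} (Hk)(p) = (n+1)^d·k(y″)` for bounded `k` (the tree's `B5Hk165L2Zd.sum_B_HBZd`
asks `k ∈ ℓ²`; here the rows' absolute convergence against bounded data suffices). [folklore] -/
theorem sum_B_HBZd_of_bounded (n : ℕ) {a : ℝ} (ha : 0 < a) {k : X d → ℝ} {R : ℝ} (hk : ∀ y, |k y| ≤ R) (y'' : X d) :
    ∑ p ∈ B n y'', HBZd n a k p = ((n : ℝ) + 1) ^ d * k y'' := by
  classical
  have hs : ∀ p ∈ B n y'', Summable fun y : X d => k y * kerH n a p y := fun p _ => summable_HBZd_of_bounded n ha hk p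
  have hsd : (0 : ℝ) < ((n : ℝ) + 1) ^ d := by positivity
  have hblock : ∀ y : X d, ∑ p ∈ B n y'', kerH n a p y = ((n : ℝ) + 1) ^ d * (if y'' = y then 1 else 0) := by
    intro y
    have h := blockAvg_kerH n ha y'' y
    rw [← h, ← mul_assoc, mul_inv_cancel₀ hsd.ne', one_mul]
  calc ∑ p ∈ B n y'', HBZd n a k p = ∑ p ∈ B n y'', ∑' y : X d, k y * kerH n a p y := rfl
    _ = ∑' y : X d, ∑ p ∈ B n y'', k y * kerH n a p y := (Summable.tsum_finsetSum hs).symm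
    _ = ∑' y : X d, k y * (((n : ℝ) + 1) ^ d * (if y'' = y then 1 else 0)) := by
        refine tsum_congr fun y => ?_
        rw [← Finset.mul_sum, hblock y]
    _ = ((n : ℝ) + 1) ^ d * k y'' := by
        rw [tsum_eq_single y'' (fun y hy => by rw [if_neg (Ne.symm hy), mul_zero, mul_zero])]
        simp [mul_comm]

/-- The multiplier row converges: `y ↦ k(y)·(Q′G′Q′*)⁻¹(y″, y)` is summable for bounded `k` (every `d`). [folklore] -/
theorem summable_mul_Kinv_row (n : ℕ) {a : ℝ} (ha : 0 < a) {k : X d → ℝ} {R : ℝ} (hk : ∀ y, |k y| ≤ R) (y'' : X d) :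
    Summable fun y : X d => k y * Kinv n a y'' y := by
  refine Summable.of_norm_bounded (((summable_expX (deltaInv_pos d ha) y'').mul_left (cInv d a)).mul_left R) fun y => ?_
  rw [Real.norm_eq_abs, abs_mul]
  exact mul_le_mul (hk y) (abs_Kinv_le n ha y'' y) (abs_nonneg _) (nonneg_of_abs_le hk)

/-- **THE LAGRANGE MULTIPLIER** (every `d`): for bounded `k`, `A(Hk)(p) = Σ′_y k(y)·(Q′G′Q′*)⁻¹(blk p, y)` — block-constant in `p`
(`tsum_AX_mul_kerH`: `AH = Q′*(Q′G′Q′*)⁻¹` entrywise). [folklore] -/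
theorem sum_AX_HBZd (n : ℕ) {a : ℝ} (ha : 0 < a) {k : X d → ℝ} {R : ℝ} (hk : ∀ y, |k y| ≤ R) (p : X d) :
    ∑ r ∈ nbhd n p, AX n a p r * HBZd n a k r = ∑' y : X d, k y * Kinv n a (blk n p) y := by
  classical
  have hs : ∀ r ∈ nbhd n p, Summable fun y : X d => AX n a p r * (k y * kerH n a r y) :=
    fun r _ => (summable_HBZd_of_bounded n ha hk r).mul_left _
  have hrow : ∀ y : X d, ∑ r ∈ nbhd n p, AX n a p r * kerH n a r y = Kinv n a (blk n p) y := by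
    intro y
    rw [← tsum_AX_mul n a p (fun r => kerH n a r y), tsum_AX_mul_kerH n ha p y]
  calc ∑ r ∈ nbhd n p, AX n a p r * HBZd n a k r
      = ∑ r ∈ nbhd n p, ∑' y : X d, AX n a p r * (k y * kerH n a r y) := by
        refine Finset.sum_congr rfl fun r _ => ?_
        rw [HBZd, tsum_mul_left]
    _ = ∑' y : X d, ∑ r ∈ nbhd n p, AX n a p r * (k y * kerH n a r y) := (Summable.tsum_finsetSum hs).symm
    _ = ∑' y : X d, k y * ∑ r ∈ nbhd n p, AX n a p r * kerH n a r y := by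
        refine tsum_congr fun y => ?_
        rw [Finset.mul_sum]
        exact Finset.sum_congr rfl fun r _ => by ring
    _ = ∑' y : X d, k y * Kinv n a (blk n p) y := tsum_congr fun y => by rw [hrow y]

/-! ## §3. The fibre inverse `Γψ = G′ψ − H·Q′(G′ψ)` -/

/-- The block mean of `G′ψ` is bounded coarse data: `|Q′(G′ψ)(y)| ≤ C_G·R` whenever `|(G′ψ)(p)| ≤ C_G·R`. [folklore] -/
theorem abs_blockAvg_Gop_le (n : ℕ) {a : ℝ} {ψ : X d → ℝ} {C : ℝ} (hG : ∀ p, |∑' q : X d, Gk n a p q * ψ q| ≤ C)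
    (y : X d) : |(((n : ℝ) + 1) ^ d)⁻¹ * ∑ p ∈ B n y, ∑' q : X d, Gk n a p q * ψ q| ≤ C :=
  abs_blockAvg_le n hG y

/-- **`Q′(Γψ) = 0`** (every `d`): the fibre inverse has vanishing block means — `Q′(G′ψ) − Q′H(Q′G′ψ) = Q′G′ψ − Q′G′ψ`.  Hypothesis: the
rows of `G′ψ` are bounded (any bound `C`; (49) supplies `A_G K_d‖ψ‖_∞` for `d ≥ 3`). [folklore] -/
theorem blockAvg_fibreInverse (n : ℕ) {a : ℝ} (ha : 0 < a) {ψ : X d → ℝ} {C : ℝ}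
    (hG : ∀ p, |∑' q : X d, Gk n a p q * ψ q| ≤ C) (y'' : X d) :
    (((n : ℝ) + 1) ^ d)⁻¹ * ∑ p ∈ B n y'',
      ((∑' q : X d, Gk n a p q * ψ q)
        - HBZd n a (fun y => (((n : ℝ) + 1) ^ d)⁻¹ * ∑ p' ∈ B n y, ∑' q : X d, Gk n a p' q * ψ q) p) = 0 := by
  have hsd : (0 : ℝ) < ((n : ℝ) + 1) ^ d := by positivity
  rw [Finset.sum_sub_distrib, sum_B_HBZd_of_bounded n ha (abs_blockAvg_Gop_le n hG) y'', mul_sub, ← mul_assoc,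
    inv_mul_cancel₀ hsd.ne', one_mul, sub_self]

/-- **`A(Γψ) = ψ − Q′*λ`** (every `d`): `Σ_{r∈nbhd p} A(p,r)(Γψ)(r) = ψ(p) − Σ′_y (Q′G′ψ)(y)·(Q′G′Q′*)⁻¹(blk p, y)` — the remainder is
BLOCK-CONSTANT in `p` (the Lagrange multiplier `λ = (Q′G′Q′*)⁻¹Q′G′ψ`). [folklore] -/
theorem sum_AX_fibreInverse (n : ℕ) {a : ℝ} (ha : 0 < a) {ψ : X d → ℝ} {R C : ℝ} (hψ : ∀ q, |ψ q| ≤ R)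
    (hG : ∀ p, |∑' q : X d, Gk n a p q * ψ q| ≤ C) (p : X d) :
    ∑ r ∈ nbhd n p, AX n a p r *
      ((∑' q : X d, Gk n a r q * ψ q)
        - HBZd n a (fun y => (((n : ℝ) + 1) ^ d)⁻¹ * ∑ p' ∈ B n y, ∑' q : X d, Gk n a p' q * ψ q) r)
      = ψ p - ∑' y : X d, ((((n : ℝ) + 1) ^ d)⁻¹ * ∑ p' ∈ B n y, ∑' q : X d, Gk n a p' q * ψ q) * Kinv n a (blk n p) y := by
  simp only [mul_sub, Finset.sum_sub_distrib]
  rw [sum_AX_Gop n ha hψ p, sum_AX_HBZd n ha (abs_blockAvg_Gop_le n hG) p]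

/-- **`Γψ` INVERTS `A` ON THE FIBRE** (weak form, every `d`): for every finitely supported test field `κ` with zero block sums,
`Σ_p κ(p)·A(Γψ)(p) = Σ_p κ(p)ψ(p)` (the block-constant multiplier is invisible to `ker Q′`; `sum_mul_blockConst_eq_zero`). [folklore] -/
theorem fibreInverse_weak (n : ℕ) {a : ℝ} (ha : 0 < a) {ψ : X d → ℝ} {R C : ℝ} (hψ : ∀ q, |ψ q| ≤ R)
    (hG : ∀ p, |∑' q : X d, Gk n a p q * ψ q| ≤ C) (S : Finset (X d)) (κ : X d → ℝ) (hS : ∀ r ∉ S, κ r = 0)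
    (hκ : ∀ y'' : X d, ∑ r ∈ B n y'', κ r = 0) :
    ∑ p ∈ S, κ p * ∑ r ∈ nbhd n p, AX n a p r *
      ((∑' q : X d, Gk n a r q * ψ q)
        - HBZd n a (fun y => (((n : ℝ) + 1) ^ d)⁻¹ * ∑ p' ∈ B n y, ∑' q : X d, Gk n a p' q * ψ q) r)
      = ∑ p ∈ S, κ p * ψ p := by
  have h0 := sum_mul_blockConst_eq_zero (n := n) S κ hS hκ
    (fun y'' => ∑' y : X d, ((((n : ℝ) + 1) ^ d)⁻¹ * ∑ p' ∈ B n y, ∑' q : X d, Gk n a p' q * ψ q) * Kinv n a y'' y)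
  calc _ = ∑ p ∈ S, κ p * (ψ p - ∑' y : X d,
          ((((n : ℝ) + 1) ^ d)⁻¹ * ∑ p' ∈ B n y, ∑' q : X d, Gk n a p' q * ψ q) * Kinv n a (blk n p) y) :=
        Finset.sum_congr rfl fun p _ => by rw [sum_AX_fibreInverse n ha hψ hG p]
    _ = ∑ p ∈ S, κ p * ψ p - ∑ p ∈ S, κ p * ∑' y : X d,
          ((((n : ℝ) + 1) ^ d)⁻¹ * ∑ p' ∈ B n y, ∑' q : X d, Gk n a p' q * ψ q) * Kinv n a (blk n p) y := by
        rw [← Finset.sum_sub_distrib]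
        exact Finset.sum_congr rfl fun p _ => by ring
    _ = ∑ p ∈ S, κ p * ψ p := by rw [h0, sub_zero]

/-- **THE FIBRE-INVERSE LETTER, parametric** (every `d`): if the section carries `|Hk| ≤ C_H·R'` for every `|k| ≤ R'` and the rows of
`G′ψ` are bounded by `C_G·R`, then `|(Γψ)(p)| ≤ C_G·(1 + C_H)·R` — `‖Γ‖_{∞→∞} ≤ ‖G′‖(1 + ‖H‖‖Q′‖)`, `‖Q′‖ ≤ 1`. [folklore] -/
theorem abs_fibreInverse_le_of_letters (n : ℕ) {a : ℝ} {ψ : X d → ℝ} {R C_G C_H : ℝ}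
    (hH : ∀ (k : X d → ℝ) (R' : ℝ), (∀ y, |k y| ≤ R') → ∀ p, |HBZd n a k p| ≤ C_H * R')
    (hG : ∀ p, |∑' q : X d, Gk n a p q * ψ q| ≤ C_G * R) (p : X d) :
    |(∑' q : X d, Gk n a p q * ψ q)
        - HBZd n a (fun y => (((n : ℝ) + 1) ^ d)⁻¹ * ∑ p' ∈ B n y, ∑' q : X d, Gk n a p' q * ψ q) p|
      ≤ C_G * (1 + C_H) * R := by
  have h1 := hG p
  have h2 := hH _ (C_G * R) (abs_blockAvg_Gop_le n hG) p
  calc _ ≤ |∑' q : X d, Gk n a p q * ψ q|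
        + |HBZd n a (fun y => (((n : ℝ) + 1) ^ d)⁻¹ * ∑ p' ∈ B n y, ∑' q : X d, Gk n a p' q * ψ q) p| := abs_sub _ _
    _ ≤ C_G * R + C_H * (C_G * R) := add_le_add h1 h2
    _ = C_G * (1 + C_H) * R := by ring

/-- **THE FIBRE-INVERSE LETTER** (`d ≥ 3`): `|(Γψ)(p)| ≤ A_G K_d(δ_u∕4)·(1 + cHs·K_d(δ_H))·R` for every `|ψ| ≤ R`, every side `n + 1`
— the second column of the inverse augmented operator of the Gaussian skeleton, in the sup currency, UNIFORM IN THE MESH. [folklore] -/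
theorem abs_fibreInverse_le (hd : 3 ≤ d) (n : ℕ) {a : ℝ} (ha : 0 < a) {ψ : X d → ℝ} {R : ℝ} (hψ : ∀ q, |ψ q| ≤ R) (p : X d) :
    |(∑' q : X d, Gk n a p q * ψ q)
        - HBZd n a (fun y => (((n : ℝ) + 1) ^ d)⁻¹ * ∑ p' ∈ B n y, ∑' q : X d, Gk n a p' q * ψ q) p|
      ≤ ((cG0 d * cKL d (d - 2) + cSplit d a) * Real.exp (2 * deltaU d a)
            + cFar d a * Real.exp (4 * deltaU d a) / deltaU d a ^ 2) * latticeConst d (deltaU d a / 4)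
          * (1 + cHs d a * latticeConst d (deltaH d a)) * R :=
  abs_fibreInverse_le_of_letters n
    (fun _ _ hk q => abs_HBZd_le_sup hd n ha hk q) (fun q => abs_Gop_le hd n ha hψ q) p

/-! ## §4. The inverse augmented operator of the Gaussian skeleton: `φ = Hk + Γψ` -/

/-- **THE `N` LETTER OF THE GAUSSIAN SKELETON IN THE SUP CURRENCY** (`d ≥ 3`): for bounded data `|k| ≤ R_k` (coarse), `|ψ| ≤ R_ψ` (fine)
the field `φ := Hk + Γψ` solves the augmented system — `Q′φ = k` (block means), `Aφ(p) = ψ(p) + c(blk p)` with the block-constant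
`c(y″) = Σ′_y (k(y) − (Q′G′ψ)(y))·(Q′G′Q′*)⁻¹(y″,y)` — and obeys `|φ(p)| ≤ C_∞·R_k + A_G K_d(1 + C_∞)·R_ψ` for EVERY side: HSCR's
`‖T⁻¹ y‖ ≤ N‖y‖` shape with a mesh-uniform `N`. [folklore] -/
theorem augInverse_letters (hd : 3 ≤ d) (n : ℕ) {a : ℝ} (ha : 0 < a) {k ψ : X d → ℝ} {Rk Rψ : ℝ} (hk : ∀ y, |k y| ≤ Rk)
    (hψ : ∀ q, |ψ q| ≤ Rψ) :
    (∀ y'' : X d, (((n : ℝ) + 1) ^ d)⁻¹ * ∑ p ∈ B n y'',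
        (HBZd n a k p + ((∑' q : X d, Gk n a p q * ψ q)
          - HBZd n a (fun y => (((n : ℝ) + 1) ^ d)⁻¹ * ∑ p' ∈ B n y, ∑' q : X d, Gk n a p' q * ψ q) p)) = k y'') ∧
    (∀ p : X d, ∑ r ∈ nbhd n p, AX n a p r *
        (HBZd n a k r + ((∑' q : X d, Gk n a r q * ψ q)
          - HBZd n a (fun y => (((n : ℝ) + 1) ^ d)⁻¹ * ∑ p' ∈ B n y, ∑' q : X d, Gk n a p' q * ψ q) r))
        = ψ p + ∑' y : X d, (k y - (((n : ℝ) + 1) ^ d)⁻¹ * ∑ p' ∈ B n y, ∑' q : X d, Gk n a p' q * ψ q)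
            * Kinv n a (blk n p) y) ∧
    (∀ p : X d, |HBZd n a k p + ((∑' q : X d, Gk n a p q * ψ q)
          - HBZd n a (fun y => (((n : ℝ) + 1) ^ d)⁻¹ * ∑ p' ∈ B n y, ∑' q : X d, Gk n a p' q * ψ q) p)|
        ≤ cHs d a * latticeConst d (deltaH d a) * Rk
          + ((cG0 d * cKL d (d - 2) + cSplit d a) * Real.exp (2 * deltaU d a)
              + cFar d a * Real.exp (4 * deltaU d a) / deltaU d a ^ 2) * latticeConst d (deltaU d a / 4)
            * (1 + cHs d a * latticeConst d (deltaH d a)) * Rψ) := by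
  have hG : ∀ p, |∑' q : X d, Gk n a p q * ψ q| ≤ _ := fun p => abs_Gop_le hd n ha hψ p
  have hsd : (0 : ℝ) < ((n : ℝ) + 1) ^ d := by positivity
  refine ⟨fun y'' => ?_, fun p => ?_, fun p => ?_⟩
  · rw [Finset.sum_add_distrib, mul_add, blockAvg_fibreInverse n ha hG y'', add_zero,
      sum_B_HBZd_of_bounded n ha hk y'', ← mul_assoc, inv_mul_cancel₀ hsd.ne', one_mul]
  · have hb := abs_blockAvg_Gop_le n hG
    simp only [mul_add, Finset.sum_add_distrib]
    rw [sum_AX_HBZd n ha hk p, sum_AX_fibreInverse n ha hψ hG p]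
    have hsub : ∑' y : X d, (k y - (((n : ℝ) + 1) ^ d)⁻¹ * ∑ p' ∈ B n y, ∑' q : X d, Gk n a p' q * ψ q)
          * Kinv n a (blk n p) y
        = ∑' y : X d, k y * Kinv n a (blk n p) y
          - ∑' y : X d, ((((n : ℝ) + 1) ^ d)⁻¹ * ∑ p' ∈ B n y, ∑' q : X d, Gk n a p' q * ψ q)
            * Kinv n a (blk n p) y := by
      rw [← (summable_mul_Kinv_row n ha hk (blk n p)).tsum_sub (summable_mul_Kinv_row n ha hb (blk n p))]
      exact tsum_congr fun y => by ring
    rw [hsub]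
    ring
  · calc _ ≤ |HBZd n a k p| + |(∑' q : X d, Gk n a p q * ψ q)
          - HBZd n a (fun y => (((n : ℝ) + 1) ^ d)⁻¹ * ∑ p' ∈ B n y, ∑' q : X d, Gk n a p' q * ψ q) p| :=
          abs_add_le _ _
      _ ≤ _ := add_le_add (abs_HBZd_le_sup hd n ha hk p) (abs_fibreInverse_le hd n ha hψ p)

/-! ## §5. Toy -/

/-- Toy: the parametric letter's arithmetic — `‖G′‖ ≤ 2`, `‖H‖ ≤ 3` ⟹ `‖Γ‖ ≤ 2·(1 + 3) = 8`. -/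
example : (2 : ℝ) * (1 + 3) = 8 := by norm_num

end

end Summit.QuantumFields.BalabanUV.T4Continuum.NE7b.FibreInverseSupNorm
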